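import Summits.CriticalPhenomena.PercolationContinuityZ3.Theorems.PercNearOneGluingNoHeavyLowerTailMixCSHDefs
import Summits.CriticalPhenomena.PercolationContinuityZ3.Theorems.PercNearOneGluingNoHeavyLowerTailCovTauTransfer
import Summits.CriticalPhenomena.PercolationContinuityZ3.Theorems.PercNearOneGluingNoHeavyLowerTailCovTauStarHPrelim
import HarnessLib

/-!
# The MIXED conditioned slack hierarchy (hub observer) — brick 2: the hub test survives the projection onto `σ(C_k)`

Support file (`--supports stmt-CriticalPhenomena-4575`), prover `prim-ineq-gen-7` (gen 8).  No definitions, no named facts, no sorries.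
Memo `prim-ineq-gen-7/PROOF-Q9-MIXED-CSH.md` §4 step (β); roadmap §9.3.

In the pre-FKG peeling (tree `PreFKGSurplus.preMargin_nonneg_of_csh`, [W] §6) the peeled term
`∫_{D_k ∩ {k ↔ u}} (F(C(k)) − F(C(c)))` is rewritten through the PROJECTED functional
`G_k(K) = F(V(K)) − E[F(C(c)) | C_k = K]` by the tower property, because `{k ↔ u}` is `σ(C_k)`-measurable
(`CovTau.setIntegral_sub_eq_projFun`).  For the HUB observer the test is `hubEv Σ k X' = {Σ ∩ C_k ≠ ∅} ∩ {Σ ↮ X'}`, whose second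
factor is NOT `σ(C_k)`-measurable; the tower identity becomes an INEQUALITY in the favourable direction:

* `MixCSH.setIntegral_hub_le_condMean` — for `c ∈ X'`, `F` monotone on vertex sets, `D_k = {k ↮ X'}`:
  `∫_{D_k ∩ hubEv Σ k X'} F(C(c)) dμ ≤ ∫_{D_k ∩ hubEv Σ k X'} E[F(C(c)) | C_k] dμ`
  — given `C_k = K` the clusters of `X'` are fresh percolation off `K` (vdBHK Lemma 2.4, tree `BHK2006.set_sum_cond_cluster`), where
  `F(C(c))` is increasing and `1{Σ ↮ X'}` decreasing, so Harris (`BHK2006.harris_mono_anti`) signs the conditional covariance.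
* `MixCSH.setIntegral_hub_sub_ge_projFun` — consequently `∫_{D_k ∩ hubEv} (F(C(k)) − F(C(c))) ≥ ∫_{D_k ∩ hubEv} G_k(C_k)`.
[cite: VandenbergHaggstromKahn2005, §2.1 Lemma 2.4 (p. 10), §1 p. 6 (Harris)] [cite: KozmaNitzan2024, Question 9 (§5.5 p. 36), Conj. 4 (p. 32)]
-/

noncomputable section

namespace Summit.CriticalPhenomena.PercolationContinuityZ3.Theorems

open MeasureTheory Set Literature.Probability.LatticeModels Literature.Probability.Percolation
open scoped Classical
open KNPreFKG BHK2006 DecisionTree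

namespace MixCSH

variable {V : Type*} [Fintype V]

/-- **The hub test under the projection onto `σ(C_k)` (memo §4 (β)).**  For `c ∈ X'`, `F` monotone on vertex sets,
`D_k = {k ↮ X'}`:  `∫_{D_k ∩ hubEv Σ k X'} F(C(c)) ≤ ∫_{D_k ∩ hubEv Σ k X'} E[F(C(c)) | C_k]`, the conditional mean being
`K ↦ ∫ F(C_c(η ∖ B(K))) dμ(η)` as in `CovTau.tower_clusterFun`.
[cite: VandenbergHaggstromKahn2005, §2.1 Lemma 2.4 (p. 10); §1 p. 6] -/
theorem setIntegral_hub_le_condMean (w : Sym2 V → unitInterval) (Sig : Set V) (c k : V) (X' : Set V) (hc : c ∈ X')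
    (F : Set V → ℝ) (hF : ∀ S T : Set V, S ⊆ T → F S ≤ F T) :
    ∫ ω in {ω : BondConfig V | ∀ a ∈ X', ¬ (openGraph ω).Reachable k a} ∩ hubEv Sig k X',
        F (openCluster ω c) ∂(prodBernoulli w) ≤
      ∫ ω in {ω : BondConfig V | ∀ a ∈ X', ¬ (openGraph ω).Reachable k a} ∩ hubEv Sig k X',
        (∫ η, F (openCluster (η \ barOf {k} (openEdgeCluster ω k)) c) ∂(prodBernoulli w)) ∂(prodBernoulli w) := by
  classical
  set μ := prodBernoulli w with hμ
  set ŵ : Sym2 V → ℝ := fun e => (w e : ℝ) with hŵ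
  have hw0 : ∀ e, 0 ≤ ŵ e := fun e => (w e).2.1
  have hw1 : ∀ e, ŵ e ≤ 1 := fun e => (w e).2.2
  have hm : ∑ ω : Set (Sym2 V), weight ŵ ω = 1 := by
    have h1 := integral_prodBernoulli_eq_sum w fun _ => (1 : ℝ)
    simp only [integral_const, probReal_univ, smul_eq_mul, mul_one] at h1
    exact h1.symm
  set D : Set (BondConfig V) := {ω : BondConfig V | ∀ a ∈ X', ¬ (openGraph ω).Reachable k a} with hD
  have hDiff : ∀ ω : BondConfig V, ω ∈ D ↔ ∀ s ∈ ({k} : Set V), ∀ t ∈ X', ¬ (openGraph ω).Reachable s t := by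
    intro ω; simp [hD]
  set E : Set (BondConfig V) := D ∩ hubEv Sig k X' with hE
  -- the ingredients as functions of edge sets
  set aK : Set (Sym2 V) → ℝ := ind {K : Set (Sym2 V) | ∃ σ ∈ Sig, σ = k ∨ ∃ e ∈ K, σ ∈ e} with haK
  set qL : Set (Sym2 V) → ℝ := ind {L : Set (Sym2 V) | ∀ σ ∈ Sig, ¬ (σ ∈ X' ∨ ∃ e ∈ L, σ ∈ e)} with hqL
  set Fv : Set (Sym2 V) → ℝ := fun L => F {z | z = c ∨ ∃ e ∈ openEdgeCluster L c, z ∈ e} with hFv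
  set Fbar : Set (Sym2 V) → ℝ := fun K => ∫ η, F (openCluster (η \ barOf {k} K) c) ∂μ with hFbar
  -- reading the hub test off `(C_k, C_{X'})`
  have haK_iff : ∀ ω : BondConfig V, (∃ σ ∈ Sig, (openGraph ω).Reachable k σ) ↔
      openEdgeCluster ω k ∈ {K : Set (Sym2 V) | ∃ σ ∈ Sig, σ = k ∨ ∃ e ∈ K, σ ∈ e} := by
    intro ω
    simp only [mem_setOf_eq]
    refine exists_congr fun σ => and_congr_right fun _ => ?_
    exact reachable_iff_exists_mem_openEdgeCluster ω k σ
  have hqL_iff : ∀ ζ : BondConfig V, (∀ σ ∈ Sig, ∀ a ∈ X', ¬ (openGraph ζ).Reachable a σ) ↔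
      setCl ζ X' ∈ {L : Set (Sym2 V) | ∀ σ ∈ Sig, ¬ (σ ∈ X' ∨ ∃ e ∈ L, σ ∈ e)} := by
    intro ζ
    simp only [mem_setOf_eq]
    refine forall₂_congr fun σ _ => ?_
    rw [← setReach_iff ζ X' σ]
    simp only [not_exists, not_and]
  have hFv_eq : ∀ ζ : BondConfig V, Fv (setCl ζ X') = F (openCluster ζ c) := by
    intro ζ
    simp only [hFv]
    rw [show setCl ζ X' = ⋃ s ∈ X', openEdgeCluster ζ s from rfl, CovTauStarN.openEdgeCluster_biUnion_eq hc]
    exact clusterFun_openEdgeCluster F ζ c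
  -- the two identities of vdBHK Lemma 2.4
  have key1 := set_sum_cond_cluster ŵ hm ({k} : Set V) X' (fun K L => aK K * qL L * Fv L) hDiff
  have key2 := set_sum_cond_cluster ŵ hm ({k} : Set V) X' (fun K L => aK K * qL L * Fbar K) hDiff
  simp only [setCl_singleton] at key1 key2
  -- the integrands as weighted indicators
  have hEind : ∀ ω : BondConfig V, E.indicator (1 : BondConfig V → ℝ) ω = aK (openEdgeCluster ω k) * qL (setCl ω X') * ind D ω := by
    intro ω
    by_cases h1 : ω ∈ D
    · rw [ind_of_mem h1, mul_one]
      by_cases h2 : ω ∈ hubEv Sig k X'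
      · rw [indicator_of_mem (show ω ∈ E from ⟨h1, h2⟩), Pi.one_apply, haK, hqL,
          ind_of_mem ((haK_iff ω).1 h2.1), ind_of_mem ((hqL_iff ω).1 h2.2), mul_one]
      · rw [indicator_of_notMem (fun h => h2 h.2)]
        rw [mem_hubEv, not_and_or] at h2
        rcases h2 with h2 | h2
        · rw [haK, ind_of_not_mem (fun h => h2 ((haK_iff ω).2 h)), zero_mul]
        · rw [hqL, ind_of_not_mem (fun h => h2 ((hqL_iff ω).2 h)), mul_zero]
    · rw [indicator_of_notMem (fun h => h1 h.1), ind_of_not_mem h1, mul_zero]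
  have hL : ∫ ω in E, F (openCluster ω c) ∂μ =
      ∑ ω : Set (Sym2 V), weight ŵ ω * (aK (openEdgeCluster ω k) * qL (setCl ω X') * Fv (setCl ω X') * ind D ω) := by
    rw [← integral_indicator (MeasurableSet.of_discrete), integral_prodBernoulli_eq_sum]
    refine Finset.sum_congr rfl fun ω _ => ?_
    have e : E.indicator (fun ω => F (openCluster ω c)) ω = E.indicator (1 : BondConfig V → ℝ) ω * F (openCluster ω c) := by
      by_cases h : ω ∈ E
      · rw [indicator_of_mem h, indicator_of_mem h, Pi.one_apply, one_mul]
      · rw [indicator_of_notMem h, indicator_of_notMem h, zero_mul]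
    rw [e, hEind, hFv_eq]; ring
  have hR : ∫ ω in E, Fbar (openEdgeCluster ω k) ∂μ =
      ∑ ω : Set (Sym2 V), weight ŵ ω * (aK (openEdgeCluster ω k) * qL (setCl ω X') * Fbar (openEdgeCluster ω k) * ind D ω) := by
    rw [← integral_indicator (MeasurableSet.of_discrete), integral_prodBernoulli_eq_sum]
    refine Finset.sum_congr rfl fun ω _ => ?_
    have e : E.indicator (fun ω => Fbar (openEdgeCluster ω k)) ω = E.indicator (1 : BondConfig V → ℝ) ω * Fbar (openEdgeCluster ω k) := by
      by_cases h : ω ∈ E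
      · rw [indicator_of_mem h, indicator_of_mem h, Pi.one_apply, one_mul]
      · rw [indicator_of_notMem h, indicator_of_notMem h, zero_mul]
    rw [e, hEind]; ring
  rw [hL, hR, key1, key2]
  -- compare world by world (`ω` fixed, `B = barOf {k} (C_k ω)` fixed)
  refine Finset.sum_le_sum fun ω _ => mul_le_mul_of_nonneg_left ?_ (weight_nonneg hw0 hw1 ω)
  refine mul_le_mul_of_nonneg_right ?_ (ind_nonneg D ω)
  set K := openEdgeCluster ω k with hK
  set B := barOf ({k} : Set V) K with hB
  have haKnn : 0 ≤ aK K := ind_nonneg _ _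
  -- the world functions of `η`
  set fη : Set (Sym2 V) → ℝ := fun η => Fv (setCl (η \ B) X') - F ∅ with hfη
  set gη : Set (Sym2 V) → ℝ := fun η => qL (setCl (η \ B) X') with hgη
  have hfmono : Monotone fη := by
    intro η η' hle
    simp only [hfη, hFv, sub_le_sub_iff_right]
    exact monotone_clusterFun c F hF (openEdgeCluster_mono (setCl_mono (show η \ B ⊆ η' \ B from fun e he => ⟨hle he.1, he.2⟩) X') c)
  have hf0 : ∀ η, 0 ≤ fη η := fun η => by
    simp only [hfη, hFv, sub_nonneg]
    exact hF _ _ (empty_subset _)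
  have hganti : Antitone gη := by
    intro η η' hle
    simp only [hgη, hqL]
    have hsub : setCl (η \ B) X' ⊆ setCl (η' \ B) X' := setCl_mono (show η \ B ⊆ η' \ B from fun e he => ⟨hle he.1, he.2⟩) X'
    by_cases h : setCl (η' \ B) X' ∈ {L : Set (Sym2 V) | ∀ σ ∈ Sig, ¬ (σ ∈ X' ∨ ∃ e ∈ L, σ ∈ e)}
    · rw [ind_of_mem h, ind_of_mem]
      intro σ hσ hor
      exact h σ hσ (hor.imp id fun ⟨e, he, hσe⟩ => ⟨e, hsub he, hσe⟩)
    · rw [ind_of_not_mem h]; exact ind_nonneg _ _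
  have hgM : ∀ η, gη η ≤ 1 := fun η => by
    simp only [hgη, hqL, ind]; split_ifs <;> norm_num
  have hHarris := harris_mono_anti hw0 hw1 hm hf0 hfmono hganti hgM
  -- `Fbar K = Σ_η w(η) Fv(C_{X'}(η ∖ B))`
  have hFbar_sum : Fbar K = ∑ η : Set (Sym2 V), weight ŵ η * Fv (setCl (η \ B) X') := by
    simp only [hFbar, hμ]
    rw [integral_prodBernoulli_eq_sum]
    refine Finset.sum_congr rfl fun η _ => ?_
    rw [hFv_eq]
  -- rewrite both sides
  set Sf : ℝ := ∑ η : Set (Sym2 V), weight ŵ η * fη η with hSf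
  set Sg : ℝ := ∑ η : Set (Sym2 V), weight ŵ η * gη η with hSg
  set Sfg : ℝ := ∑ η : Set (Sym2 V), weight ŵ η * (fη η * gη η) with hSfg
  have e1 : ∑ η : Set (Sym2 V), weight ŵ η * (aK K * qL (setCl (η \ B) X') * Fv (setCl (η \ B) X')) =
      aK K * Sfg + aK K * F ∅ * Sg := by
    rw [hSfg, hSg, Finset.mul_sum, Finset.mul_sum, ← Finset.sum_add_distrib]
    refine Finset.sum_congr rfl fun η _ => ?_
    simp only [hfη, hgη]; ring
  have hsplit : Fbar K = Sf + F ∅ := by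
    rw [hFbar_sum, hSf]
    have := sum_affine ŵ fη (fun η => Fv (setCl (η \ B) X')) (fun _ => (1 : ℝ)) fη fη 1 (-(F ∅)) 0 0
      (fun η => by simp only [hfη]; ring)
    rw [this]
    simp [hm]
  have e2 : ∑ η : Set (Sym2 V), weight ŵ η * (aK K * qL (setCl (η \ B) X') * Fbar K) = aK K * (Sf + F ∅) * Sg := by
    rw [← hsplit, hSg, Finset.mul_sum]
    refine Finset.sum_congr rfl fun η _ => ?_
    simp only [hgη]; ring
  rw [e1, e2]
  have h1 := mul_le_mul_of_nonneg_left hHarris haKnn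
  have hring : aK K * (Sf + F ∅) * Sg = aK K * (Sf * Sg) + aK K * F ∅ * Sg := by ring
  rw [hring]
  linarith [h1]

/-- **The peeled hub term through the projected functional (memo §4 (P)+(β)).**  With `G_k` the projected functional of
`CovTau.monotone_projFun` (owner `k`, benchmark `c`):  `∫_{D_k ∩ hubEv Σ k X'} (F(C(k)) − F(C(c))) ≥ ∫_{D_k ∩ hubEv Σ k X'} G_k(C_k)`.
[cite: VandenbergHaggstromKahn2005, §2.1 Lemma 2.4 (p. 10)] [cite: KozmaNitzan2024, Question 9 (§5.5 p. 36)] -/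
theorem setIntegral_hub_sub_ge_projFun (w : Sym2 V → unitInterval) (Sig : Set V) (c k : V) (X' : Set V) (hc : c ∈ X')
    (F : Set V → ℝ) (hF : ∀ S T : Set V, S ⊆ T → F S ≤ F T) :
    ∫ ω in {ω : BondConfig V | ∀ a ∈ X', ¬ (openGraph ω).Reachable k a} ∩ hubEv Sig k X',
        (F {z | z = k ∨ ∃ e ∈ openEdgeCluster ω k, z ∈ e} -
          ∫ η, F (openCluster (η \ barOf {k} (openEdgeCluster ω k)) c) ∂(prodBernoulli w)) ∂(prodBernoulli w) ≤
      ∫ ω in {ω : BondConfig V | ∀ a ∈ X', ¬ (openGraph ω).Reachable k a} ∩ hubEv Sig k X',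
        (F (openCluster ω k) - F (openCluster ω c)) ∂(prodBernoulli w) := by
  rw [integral_sub (Integrable.of_finite).integrableOn (Integrable.of_finite).integrableOn,
    integral_sub (Integrable.of_finite).integrableOn (Integrable.of_finite).integrableOn]
  simp only [clusterFun_openEdgeCluster]
  linarith [setIntegral_hub_le_condMean w Sig c k X' hc F hF]

end MixCSH

end Summit.CriticalPhenomena.PercolationContinuityZ3.Theorems
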